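import Summits.QuantumFields.BalabanUV.T4Continuum.Support.NE9Lemma1RemainderSpecies
import Summits.QuantumFields.BalabanUV.T4Continuum.Support.NE9Lemma1PieceClassTwoRate

/-!
# NE9Lemma1KernelSpecies — the SECOND species family of leaf S5 at FORM level: the POINT-LOCALIZED terms of [I] §4
# ((4.20)–(4.30), orders 2–4 of (3.34) after the Ward–Takahashi reorganisation (4.15)), whose per-piece bound is the
# (4.22) mechanism «kernel point-decay × field factors, summed over the points with ⅔ of κd_j(X) spent on the sums» —
# a TWO-RATE class-relative per-piece binder (input rate κ, output rate κ′ ≤ κ) and its S5 leaf, and the kernel species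
# datum `KerData` with the (4.22) arithmetic PROVED from the displayed p. 286 summand bound, geometry and lattice sums
# (cell `pub-balaban`, T4-DAG §2 node U3 / §6 NE9; lineage t4-ne9-p1 = row NE9 OWNER, generation 25; census E52)

HONEST FRAMING (T4-DAG PAGE 1).  Rung (B)+1 of the FINITE-VOLUME T⁴ programme — NOT infinite volume, NOT a mass gap, NOT the
Clay problem.  NE9 (`T4OutputRate.NE9` ∧ `FadingMemory`) is a cell NEW ESTIMATE, NOT PRINTED, NOT discharged here; spine 0/9.
HONEST DEPENDENCY (cell line, verbatim): continuum YM on T⁴ ⇐ BetaPertH ∧ nine spine estimates (0/9 proved); BetaPertH ⇐ (D1)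
∧ (D4) ∧ CAP+tail; G-an2-4 gates asym, D1 and NE2/3/4.  `FlowStep.BetaPertH`, (B), (B^μ) do not occur.  [I] = [Balaban1987RG1]
(CMP **109**), [II] = [Balaban1988RG2Cluster] (CMP **116**) are quoted for TYPES only (ABSOLUTE RULE: nothing printed in the
audited series is asserted).

WHERE THIS SITS (skeleton `t4/b2b-balaban-t4-ne9-p1/SKELETON-NE9-P1.md` §3 row S5, §4 O-NE9-2; record §32.4 E52).  The channel
`T_k` of the NE9 frame reads an old term `H` created at step j through the localized pieces (1.23)/(1.33) of [II]; their
per-creation-step gain has TWO sources in [I]: (a) the fifth-order remainder of (3.34) — gain (L^jη)⁵ by (3.54), PROVED on the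
analytic class along Bałaban's slice curves (`NE9Lemma1CurveSpecies`, gen 25); (b) the orders 2–4 of (3.34) AFTER the
Ward–Takahashi reorganisation of [I] §4 ((4.9)–(4.15) pp. 283–284): point-localized multilinear terms (4.20)–(4.21) p. 285,
(4.24)–(4.30) pp. 287–288, bounded by the mechanism of (4.22) p. 286 — *"A term corresponding to such a partition can be
estimated by Σ_{x,x₃}(8B₃α₂⁻¹)⁴E₀exp(−κd_j(X) − δ₀dist^{(ξ)}(X,x) − δ₀dist^{(ξ)}(X,x₃))|B|²|δB(x)||(∂B)(Γ_{x,x₃})| <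
Σ_{x,x₃}(8B₃α₁α₂⁻¹)⁴E₀exp(−⅓κd_j(X) − δ₁|x−x₀| − δ₁|x₃−x|)|x₃−x|(L^jη)⁵ … δ₁ = O(M⁻¹), because of the factor with κd_j(X).
Summing over x, x₃ we get finally … |(the second sum in (4.21))| ≦ (32B₃α₁α₂⁻¹c₀(δ₁)c₁(δ₁))⁴exp(−⅓κd_j(X))(L^jη)⁵"*, with
*"the power 4 + β instead of 5"* for the (4.30)-species (p. 288; (4.18) p. 285 *"|(∂_λ∂_νB_μ)(x)| < α₁(L^jη)^{2+β}, 0 ≦ β ≦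
β₀ < 1"*).  Two things are species-(b)-specific at FORM level: the OUTPUT DECAY RATE IS SMALLER THAN THE INPUT RATE (⅓κ vs κ:
part of the input's tree decay pays for the point sums), and the piece is a DOUBLE POINT SUM of a bilocal summand.
THIS FILE (kernel, 0 sorry; the TWO-RATE binder `PieceBoundOnG₂ Adm P κ κ′ …` — hypothesis at the input rate κ, conclusion at the
output rate κ′ — and its S5 leaf `channelSizeAtStepNN_cpieceG₂` (level counts at κ′) are the companion `NE9Lemma1PieceClassTwoRate`):
* §1 the datum **`KerData`** of the kernel species on the doubled carriers (index families, κ₁, r_k, cubes, radii R_X as before;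
  the unit-lattice POINTS `pts k y □₀` of □̃⁴, base points `p0 X ∈ X`, the ξ-distances `dX X p` = dist^{(ξ)}(X,p) and `ρd p q` =
  |p − q|, the power `m` of |x₃ − x| (1 for (4.21), 2 for (4.30)), and the BILOCAL SUMMAND `ker … t s σ p q F` — at form level a
  functional of the complex old term `F = lift H X`, in print the (x, x₃)-summand of (4.21)/(4.25)/(4.29) with the inner sums
  done by (4.3)), its piece form `KerData.toC` (piece := Re/Im of the (1.23) contour functional of `(s,σ) ↦ Σ_{p,q∈pts} ker …`),
  `PieceZero`/`PieceLocal`/`CSrcScale` under the displayed linearity-at-zero of `ker`;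
* §2 the binder structure **`KerData.Admissible ℓ gain κ w`**: κ₁ ≥ 1; r_k > 0; R_X > 0; **(K) the p. 286 summand bound as a
  TYPE** — for every `F` analytic on the ball of radius R_X and bounded by M there, on the contours
  `‖ker … p q F‖ ≤ cK·M·gain k j·(ρd p q)^m·exp(−δ₀·(dX X p + dX X q))` (PROOF-INTERIOR: (4.3) localisation ⊕ Cauchy ⊕
  (4.17)/(4.18); `gain ↔ (L^jη)⁵` or `(L^jη)^{4+β}`, `cK ↔ (8B₃α₁α₂⁻¹)⁴`); **(G) geometry** `δ₁·ρd (p0 X) p + δ₁·ρd p q ≤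
  δ₀·(dX X p + dX X q) + w·d(X) + w₀` (print: w = ⅔κ, δ₁ = O(M⁻¹)); **(S) lattice sums** `Σ_{p∈pts} exp(−δ₁ρd (p0 X) p) ≤ c₀`,
  `Σ_{q∈pts} (ρd p q)^m·exp(−δ₁ρd p q) ≤ c₁` (print's c₀(δ₁), c₁(δ₁)); source discipline; G1; nonnegativities — and the theorem
  **`pieceBoundOnG₂_ker`**: `PieceBoundOnG₂ (analyticClass R) K.toC κ (κ − w) κ₁ d₀ (Kp k = 2·cK·e^{w₀}·c₀·c₁/r_k) gain` PROVED
  (the (4.22) arithmetic ⊕ `B13Sect1Arith.bound_124`/`bound_125`), whence **`channelSizeAtStepNN_ker`** (leaf S5 for the kernel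
  species on the analytic class, level counts at κ − w) and `structureBinders_ker`.
WHAT REMAINS DISPLAYED for species (b): O1 (Bałaban's (4.21)/(4.25)/(4.29)/(4.30) irrelevant terms ARE `KerData.toC` pieces:
`ker` = the bilocalized derivative of `F ∘ Φ_{□₀}`, Φ_{□₀} = the background map B ↦ U_j(□₀, exp iB) of [I] (3.28)–(3.30),
contracted with the field factors of the contour point), (K) as a PROOF-INTERIOR TYPE statement of p. 286 (display 1 and
ll. 25–30 *"by a similar argument we can bound the derivative 𝐄^{(n)}(X, x₁, …, x_n) by a constant times the exponential
exp(−O(1)κd_j(X∪{x₁, …, x_n}))"*), (G) (the ξ-geometry of 𝐃_j-domains), (S) (unit-lattice sums), the level counts at κ − w,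
additivity of `ker` in `F` on the analytic class, and the assembly of the channel as the SUM of the species' channels.
DISGUISE TEST: one input family, one history; a size bound per piece; not NE9.

References (TYPES only): [Balaban1987RG1] T. Bałaban, CMP **109** (1987) 249–301, (3.34) p. 277, (4.3) p. 282, (4.15) p. 284,
(4.17)–(4.21) p. 285, (4.22) p. 286, (4.24)–(4.30) pp. 287–288, (0.29) p. 258; [Balaban1988RG2Cluster] T. Bałaban, CMP **116**
(1988) 1–22, (1.23)–(1.29) pp. 7–8, (1.36) p. 9.  Summits-side NEW work (LEAN PLACEMENT RULE); imports gen 24's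
`NE9Lemma1RemainderSpecies` (hence `NE9Lemma1PieceClass`, `NE9Lemma1Gain`, `B13Sect1Arith`) BY NAME; modifies nothing; 0 sorry.
Value = the second species' S5 leaf at form level with the rate loss typed, NOT summit progress.
-/

noncomputable section

namespace Summit.QuantumFields.BalabanUV.T4Continuum.NE9Lemma1KernelSpecies

open scoped BigOperators
open Metric Set Complex
open Literature.MathematicalPhysics.QuantumFieldTheory.Balaban1983to89
open Literature.MathematicalPhysics.QuantumFieldTheory.Balaban1983to89.T4OutputRate
open Literature.MathematicalPhysics.QuantumFieldTheory.Balaban1983to89.T4HistoryLipschitzRecursion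
open Summit.QuantumFields.BalabanUV.T4Continuum.NE9Lemma1Counting
open Summit.QuantumFields.BalabanUV.T4Continuum.NE9Lemma1Gain
open Summit.QuantumFields.BalabanUV.T4Continuum.NE9Lemma1PieceClass
open Summit.QuantumFields.BalabanUV.T4Continuum.NE9Lemma1PieceClassTwoRate
open Summit.QuantumFields.BalabanUV.T4Continuum.NE9Lemma1RemainderSpecies
open Summit.QuantumFields.BalabanUV.T4Continuum.NE9ComplexEncoding (doubleCarriers)

/-! ## §1 The kernel species: datum and piece form -/

section Species

variable {C : Carriers} {E : Type} {ι α β γ δ Pt : Type}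

/-- **THE DATUM OF THE KERNEL SPECIES** at FORM level ([I] §4's point-localized irrelevant terms): the index families on the
doubled carriers, κ₁, the t_□-radii `r k`, the cubes, the analyticity radii `R X` (as for the other species); the unit-lattice
POINTS `pts k y □₀` (x, x₃ ∈ □̃⁴ ∩ T₁^{(j)}, p. 285), a base point `p0 X` of X (*"x₀ is a fixed point in X"*, p. 286), the
ξ-distances `dX X p` (dist^{(ξ)}(X, p)) and `ρd p q` (|p − q|), the power `m` of |x₃ − x| (1 for (4.21), 2 for (4.30)), and the
BILOCAL SUMMAND `ker … t s σ p q F` (the (x, x₃)-summand of (4.21)/(4.25)/(4.29) for the complex old term `F`, field factors of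
the contour point (t, s, σ) included).  No inequality inside. [cite: Balaban1987RG1, (4.21) p.285, (4.22) p.286] -/
structure KerData (C : Carriers) (E : Type) (ι α β γ δ Pt : Type) where
  /-- boxes □₀ ⊂ Y -/
  S0 : ℕ → ι → Finset α
  /-- connected domains Y₀ ∋ □̃⁴ -/
  SY : ℕ → ι → α → Finset β
  /-- sources (X, re/im), X ∈ 𝐃_j, X ⊂ □̃² -/
  src : ℕ → ι → α → ℕ → Finset (doubleCarriers C).Dom
  /-- counting cubes □′ -/
  Sq : ℕ → ι → α → ℕ → Finset γ
  /-- fibres X ⊃ □′ -/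
  SX : ℕ → ι → α → ℕ → γ → Finset (doubleCarriers C).Dom
  /-- d_k(Y) -/
  dY : ℕ → ι → ℝ
  /-- κ₁ -/
  κ₁ : ℝ
  /-- t_□-radius r_k -/
  r : ℕ → ℝ
  /-- the cubes Δ ⊂ Y₀ ∖ □̃⁴ -/
  cubes : ℕ → ι → α → β → List δ
  /-- analyticity radius R_X -/
  R : C.Dom → ℝ
  /-- the unit-lattice points of □̃⁴ -/
  pts : ℕ → ι → α → Finset Pt
  /-- a base point x₀ ∈ X -/
  p0 : C.Dom → Pt
  /-- dist^{(ξ)}(X, p) -/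
  dX : C.Dom → Pt → ℝ
  /-- |p − q| in ξ-scale -/
  ρd : Pt → Pt → ℝ
  /-- the power of |x₃ − x| -/
  m : ℕ
  /-- the bilocal summand at (p, q) for the complex old term F, at the contour point (t, s, σ) -/
  ker : ℕ → (ℕ → ℝ) → ι → α → β → (doubleCarriers C).Dom → ℂ → (δ → ℝ) → (δ → ℂ) → Pt → Pt → (E → ℂ) → ℂ

variable [DecidableEq δ]

/-- The double point sum of the bilocal summand at a contour point. [folklore] -/
def KerData.dsum (K : KerData C E ι α β γ δ Pt) (k : ℕ) (s : ℕ → ℝ) (y : ι) (a : α) (b : β)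
    (x : (doubleCarriers C).Dom) (F : E → ℂ) (t : ℂ) (s' : δ → ℝ) (σ' : δ → ℂ) : ℂ :=
  ∑ p ∈ K.pts k y a, ∑ q ∈ K.pts k y a, K.ker k s y a b x t s' σ' p q F

/-- **THE PIECE FORM OF THE KERNEL SPECIES**: volumes = number of cubes; piece at the source (X, re/im) := Re/Im of the
(1.23) contour functional (t_□-circle of radius r_k, `B13Sect1Arith.cauchyOp` over the cubes) of the double point sum of the
bilocal summand for the complex old term `lift H X`. [cite: Balaban1988RG2Cluster, (1.23) p.7] -/
def KerData.toC (K : KerData C E ι α β γ δ Pt) : CPieceData (doubleCarriers C) E ι α β γ where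
  S0 := K.S0
  SY := K.SY
  src := K.src
  Sq := K.Sq
  SX := K.SX
  vol := fun k y a b => ((K.cubes k y a b).length : ℝ)
  dY := K.dY
  piece := fun k s y a b x H => reIm x.2
    ((2 * Real.pi * I : ℂ)⁻¹ • ∮ t in C(0, K.r k), (t ^ 2)⁻¹ •
      B13Sect1Arith.cauchyOp (Real.exp K.κ₁) (K.cubes k y a b) (fun s' σ' => K.dsum k s y a b x (lift H x.1) t s' σ')
        (fun _ => (0:ℝ)) (fun _ => ((Real.exp K.κ₁ : ℝ) : ℂ)))

/-- BINDER (structure): the bilocal summand VANISHES on the zero term (in print it is multilinear in the derivatives of the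
old term). [cite: Balaban1987RG1, (4.21) p.285] -/
def KerData.KerZero (K : KerData C E ι α β γ δ Pt) : Prop :=
  ∀ k s y a b x t s' σ' p q, K.ker k s y a b x t s' σ' p q (0 : E → ℂ) = 0

omit [DecidableEq δ] in
/-- The double point sum of the zero term vanishes. [folklore] -/
theorem dsum_zero {K : KerData C E ι α β γ δ Pt} (hz : K.KerZero) (k : ℕ) (s : ℕ → ℝ) (y : ι) (a : α) (b : β)
    (x : (doubleCarriers C).Dom) (t : ℂ) (s' : δ → ℝ) (σ' : δ → ℂ) : K.dsum k s y a b x (0 : E → ℂ) t s' σ' = 0 :=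
  Finset.sum_eq_zero fun p _ => Finset.sum_eq_zero fun q _ => hz k s y a b x t s' σ' p q

/-- **`PieceZero` FOR THE KERNEL SPECIES** (under `KerZero`). [folklore] -/
theorem pieceZero_ker {K : KerData C E ι α β γ δ Pt} (hz : K.KerZero) : PieceZero K.toC := by
  intro k s y a b x
  show reIm x.2 ((2 * Real.pi * I : ℂ)⁻¹ • ∮ t in C(0, K.r k), (t ^ 2)⁻¹ •
      B13Sect1Arith.cauchyOp (Real.exp K.κ₁) (K.cubes k y a b)
        (fun s' σ' => K.dsum k s y a b x (lift (0 : E → (doubleCarriers C).Dom → ℝ) x.1) t s' σ')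
        (fun _ => (0:ℝ)) (fun _ => ((Real.exp K.κ₁ : ℝ) : ℂ))) = 0
  have h : ∀ t, (fun s' σ' => K.dsum k s y a b x (lift (0 : E → (doubleCarriers C).Dom → ℝ) x.1) t s' σ') =
      fun _ _ => (0 : ℂ) := by
    intro t; funext s' σ'; rw [lift_zero]; exact dsum_zero hz k s y a b x t s' σ'
  simp only [h, cauchyOp_zero, smul_zero, circleIntegral, intervalIntegral.integral_zero, reIm_zero]

/-- **`PieceLocal` FOR THE KERNEL SPECIES**: the piece sourced at (X, ·) reads the family on the two copies of X only. [folklore] -/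
theorem pieceLocal_ker (K : KerData C E ι α β γ δ Pt) : PieceLocal K.toC := by
  intro k s y a b x H H' hHH'
  show reIm x.2 ((2 * Real.pi * I : ℂ)⁻¹ • ∮ t in C(0, K.r k), (t ^ 2)⁻¹ • B13Sect1Arith.cauchyOp _ _
      (fun s' σ' => K.dsum k s y a b x (lift H x.1) t s' σ') _ _) =
    reIm x.2 ((2 * Real.pi * I : ℂ)⁻¹ • ∮ t in C(0, K.r k), (t ^ 2)⁻¹ • B13Sect1Arith.cauchyOp _ _
      (fun s' σ' => K.dsum k s y a b x (lift H' x.1) t s' σ') _ _)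
  rw [lift_congr hHH']

/-! ## §2 The binders of the kernel species and its per-piece bound PROVED (the (4.22) arithmetic) -/

variable [NormedAddCommGroup E] [NormedSpace ℂ E]

/-- **THE BINDERS OF THE KERNEL SPECIES** (printed TYPE / PROOF-INTERIOR statements and bookkeeping, displayed — NOT proved
here): `κ₁ ≥ 1`; `r_k > 0`; `R_X > 0`; the summand vanishes on the zero term; **(K)** the p. 286 SUMMAND BOUND as a TYPE — for
every `F` analytic on the ball of radius `R_X` and bounded by `M` there, on the contours `‖ker … p q F‖ ≤ cK·M·gain k j·(ρd p
q)^m·exp(−δ₀·(dX X p + dX X q))` (*"(8B₃α₂⁻¹)⁴E₀exp(−κd_j(X) − δ₀dist^{(ξ)}(X,x) − δ₀dist^{(ξ)}(X,x₃))|B|²|δB(x)||(∂B)(Γ_{x,x₃})|"*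
with (4.17) *"|(∂_νB_μ)(x)| < … < α₁(L^jη)²"*, (4.18), and p. 286 ll. 25–30 for the general kernel — PROOF-INTERIOR of [I] §4:
(4.3) localisation ⊕ Cauchy ⊕ (3.32)); **(G)** the ξ-GEOMETRY `δ₁·ρd (p0 X) p + δ₁·ρd p q ≤ δ₀·(dX X p + dX X q) + w·d(X) + w₀`
(print: *"the decay rate is rather poor, δ₁ = O(M⁻¹), because of the factor with κd_j(X)"*, w = ⅔κ); **(S)** the LATTICE SUMS
`Σ_{p∈pts} exp(−δ₁·ρd (p0 X) p) ≤ c₀`, `Σ_{q∈pts} (ρd p q)^m·exp(−δ₁·ρd p q) ≤ c₁` (print's c₀(δ₁), c₁(δ₁)); the source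
discipline; G1 ([II] (1.25)); nonnegativities. [cite: Balaban1987RG1, (4.17)-(4.18) p.285, (4.22) p.286; Balaban1988RG2Cluster, (1.25) p.7] -/
structure KerData.Admissible (K : KerData C E ι α β γ δ Pt) (ℓ gain : ℕ → ℕ → ℝ) (cK δ₀ δ₁ w w0 c0 c1 d0 : ℝ) : Prop where
  κ₁_ge : 1 ≤ K.κ₁
  r_pos : ∀ k, 0 < K.r k
  R_pos : ∀ X, 0 < K.R X
  kerZero : K.KerZero
  kerBound : ∀ k s y, ∀ a ∈ K.S0 k y, ∀ b ∈ K.SY k y a, ∀ j, ∀ x ∈ K.src k y a j,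
    ∀ t ∈ sphere (0:ℂ) (K.r k), ∀ s' σ', OnContour K.κ₁ (K.cubes k y a b) s' σ' →
      ∀ p ∈ K.pts k y a, ∀ q ∈ K.pts k y a, ∀ (F : E → ℂ) (M : ℝ),
        DifferentiableOn ℂ F (ball 0 (K.R x.1)) → (∀ z ∈ ball (0:E) (K.R x.1), ‖F z‖ ≤ M) →
          ‖K.ker k s y a b x t s' σ' p q F‖ ≤
            cK * M * gain k j * K.ρd p q ^ K.m * Real.exp (-(δ₀ * (K.dX x.1 p + K.dX x.1 q)))
  geom : ∀ k y a (x : (doubleCarriers C).Dom), ∀ p ∈ K.pts k y a, ∀ q ∈ K.pts k y a,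
    δ₁ * K.ρd (K.p0 x.1) p + δ₁ * K.ρd p q ≤ δ₀ * (K.dX x.1 p + K.dX x.1 q) + w * C.d x.1 + w0
  sum0 : ∀ k y a (X : C.Dom), ∑ p ∈ K.pts k y a, Real.exp (-(δ₁ * K.ρd (K.p0 X) p)) ≤ c0
  sum1 : ∀ k y a, ∀ p ∈ K.pts k y a, ∑ q ∈ K.pts k y a, K.ρd p q ^ K.m * Real.exp (-(δ₁ * K.ρd p q)) ≤ c1
  srcScale : ∀ k y a j, ∀ x ∈ K.src k y a j, C.scale x.1 = j
  G1 : ∀ k y, ∀ a ∈ K.S0 k y, ∀ b ∈ K.SY k y a, K.dY k y ≤ d0 + 4 * ((K.cubes k y a b).length : ℝ)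
  d0_nonneg : 0 ≤ d0
  cK_nonneg : 0 ≤ cK
  gain_nonneg : ∀ k j, 0 ≤ gain k j
  ρd_nonneg : ∀ p q, 0 ≤ K.ρd p q
  c0_nonneg : 0 ≤ c0
  c1_nonneg : 0 ≤ c1

/-- The source discipline of the datum is part 1's `CSrcScale`. [folklore] -/
theorem csrcScale_ker {K : KerData C E ι α β γ δ Pt} {ℓ gain : ℕ → ℕ → ℝ} {cK δ₀ δ₁ w w0 c0 c1 d0 : ℝ}
    (hK : K.Admissible ℓ gain cK δ₀ δ₁ w w0 c0 c1 d0) : CSrcScale K.toC :=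
  fun k y a j x hx => hK.srcScale k y a j x hx

/-- The constant of the kernel species: `Kp k y = 2·cK·e^{w₀}·c₀·c₁/r_k` (2 from |re| + |im| of the read-back, 1/r_k from (1.22),
`cK·c₀·c₁ ↔ (32B₃α₁α₂⁻¹c₀(δ₁)c₁(δ₁))⁴` of (4.22)). [folklore] -/
def KerData.Kp (K : KerData C E ι α β γ δ Pt) (cK w0 c0 c1 : ℝ) : ℕ → ι → ℝ :=
  fun k _ => 2 * cK * Real.exp w0 * c0 * c1 / K.r k

omit [DecidableEq δ] in
/-- **THE (4.22) ARITHMETIC**: under (K), (G), (S), for `F` analytic on the ball of radius `R_X` bounded by `M` there, the double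
point sum at a contour point is bounded by `cK·e^{w₀}·c₀·c₁ · M · gain · e^{w·d(X)}` — print's *"Summing over x, x₃ we get finally
the following estimate"*, with the loss `e^{w·d(X)}` (w = ⅔κ in print) made explicit. [cite: Balaban1987RG1, (4.22) p.286] -/
theorem norm_dsum_le {K : KerData C E ι α β γ δ Pt} {ℓ gain : ℕ → ℕ → ℝ} {cK δ₀ δ₁ w w0 c0 c1 d0 : ℝ}
    (hK : K.Admissible ℓ gain cK δ₀ δ₁ w w0 c0 c1 d0) {k : ℕ} {s : ℕ → ℝ} {y : ι} {a : α} (ha : a ∈ K.S0 k y) {b : β}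
    (hb : b ∈ K.SY k y a) {j : ℕ} {x : (doubleCarriers C).Dom} (hx : x ∈ K.src k y a j) {t : ℂ}
    (ht : t ∈ sphere (0:ℂ) (K.r k)) {s' : δ → ℝ} {σ' : δ → ℂ} (hsσ : OnContour K.κ₁ (K.cubes k y a b) s' σ')
    {F : E → ℂ} {M : ℝ} (hF : DifferentiableOn ℂ F (ball 0 (K.R x.1))) (hM : ∀ z ∈ ball (0:E) (K.R x.1), ‖F z‖ ≤ M)
    (hM0 : 0 ≤ M) :
    ‖K.dsum k s y a b x F t s' σ'‖ ≤ cK * Real.exp w0 * c0 * c1 * M * gain k j * Real.exp (w * C.d x.1) := by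
  have hg := hK.gain_nonneg k j
  -- the common factor A := cK·M·gain·e^{w d + w₀}
  set A : ℝ := cK * M * gain k j * Real.exp (w * C.d x.1 + w0) with hA
  have hA0 : 0 ≤ A := mul_nonneg (mul_nonneg (mul_nonneg hK.cK_nonneg hM0) hg) (Real.exp_pos _).le
  -- pointwise: summand ≤ A · e^{−δ₁ρ(p0,p)} · (ρ^m e^{−δ₁ ρ(p,q)})   ((K) then (G))
  have hpt : ∀ p ∈ K.pts k y a, ∀ q ∈ K.pts k y a, ‖K.ker k s y a b x t s' σ' p q F‖ ≤
      A * (Real.exp (-(δ₁ * K.ρd (K.p0 x.1) p)) * (K.ρd p q ^ K.m * Real.exp (-(δ₁ * K.ρd p q)))) := by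
    intro p hp q hq
    have h1 := hK.kerBound k s y a ha b hb j x hx t ht s' σ' hsσ p hp q hq F M hF hM
    have hgeo := hK.geom k y a x p hp q hq
    have hexp : Real.exp (-(δ₀ * (K.dX x.1 p + K.dX x.1 q))) ≤
        Real.exp (w * C.d x.1 + w0) * (Real.exp (-(δ₁ * K.ρd (K.p0 x.1) p)) * Real.exp (-(δ₁ * K.ρd p q))) := by
      rw [← Real.exp_add, ← Real.exp_add]
      exact Real.exp_le_exp.mpr (by linarith)
    have hc : 0 ≤ cK * M * gain k j * K.ρd p q ^ K.m :=
      mul_nonneg (mul_nonneg (mul_nonneg hK.cK_nonneg hM0) hg) (pow_nonneg (hK.ρd_nonneg p q) _)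
    calc ‖K.ker k s y a b x t s' σ' p q F‖
          ≤ cK * M * gain k j * K.ρd p q ^ K.m * Real.exp (-(δ₀ * (K.dX x.1 p + K.dX x.1 q))) := h1
      _ ≤ cK * M * gain k j * K.ρd p q ^ K.m *
            (Real.exp (w * C.d x.1 + w0) * (Real.exp (-(δ₁ * K.ρd (K.p0 x.1) p)) * Real.exp (-(δ₁ * K.ρd p q)))) :=
          mul_le_mul_of_nonneg_left hexp hc
      _ = A * (Real.exp (-(δ₁ * K.ρd (K.p0 x.1) p)) * (K.ρd p q ^ K.m * Real.exp (-(δ₁ * K.ρd p q)))) := by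
          rw [hA]; ring
  -- inner sum over q ((S) second clause)
  have hinner : ∀ p ∈ K.pts k y a, ∑ q ∈ K.pts k y a, ‖K.ker k s y a b x t s' σ' p q F‖ ≤
      A * c1 * Real.exp (-(δ₁ * K.ρd (K.p0 x.1) p)) := by
    intro p hp
    calc ∑ q ∈ K.pts k y a, ‖K.ker k s y a b x t s' σ' p q F‖
          ≤ ∑ q ∈ K.pts k y a, A * (Real.exp (-(δ₁ * K.ρd (K.p0 x.1) p)) *
              (K.ρd p q ^ K.m * Real.exp (-(δ₁ * K.ρd p q)))) := Finset.sum_le_sum fun q hq => hpt p hp q hq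
      _ = A * Real.exp (-(δ₁ * K.ρd (K.p0 x.1) p)) *
              ∑ q ∈ K.pts k y a, K.ρd p q ^ K.m * Real.exp (-(δ₁ * K.ρd p q)) := by
          rw [Finset.mul_sum]
          exact Finset.sum_congr rfl fun q _ => by ring
      _ ≤ A * Real.exp (-(δ₁ * K.ρd (K.p0 x.1) p)) * c1 :=
          mul_le_mul_of_nonneg_left (hK.sum1 k y a p hp) (mul_nonneg hA0 (Real.exp_pos _).le)
      _ = A * c1 * Real.exp (-(δ₁ * K.ρd (K.p0 x.1) p)) := by ring
  -- outer sum over p ((S) first clause)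
  calc ‖K.dsum k s y a b x F t s' σ'‖
        ≤ ∑ p ∈ K.pts k y a, ∑ q ∈ K.pts k y a, ‖K.ker k s y a b x t s' σ' p q F‖ :=
          (norm_sum_le _ _).trans (Finset.sum_le_sum fun p _ => norm_sum_le _ _)
    _ ≤ ∑ p ∈ K.pts k y a, A * c1 * Real.exp (-(δ₁ * K.ρd (K.p0 x.1) p)) := Finset.sum_le_sum hinner
    _ = A * c1 * ∑ p ∈ K.pts k y a, Real.exp (-(δ₁ * K.ρd (K.p0 x.1) p)) := by rw [Finset.mul_sum]
    _ ≤ A * c1 * c0 := mul_le_mul_of_nonneg_left (hK.sum0 k y a x.1) (mul_nonneg hA0 hK.c1_nonneg)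
    _ = cK * Real.exp w0 * c0 * c1 * M * gain k j * Real.exp (w * C.d x.1) := by rw [hA, Real.exp_add]; ring

/-- **THE PER-PIECE BOUND OF THE KERNEL SPECIES, PROVED ON THE ANALYTIC CLASS** (two-rate form): `PieceBoundOnG₂
(analyticClass R) K.toC κ (κ − w) κ₁ d₀ (Kp = 2·cK·e^{w₀}·c₀·c₁/r_k) gain` — for an analytic family whose creation-step-j slice is
bounded by `e^{−κd}·N`, the piece sourced at (X, re/im) is bounded by `Kp·N·gain·e^{−(κ−w)d(X)}·exp(−⅛(κ₁−1)d_k(Y) + ⅛κ₁d₀ −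
½(κ₁−1)·#cubes)`.  Chain: |Re/Im| ≤ ‖·‖; `B13Sect1Arith.bound_124` on the contour functional with the integrand bound
`norm_dsum_le` (M := 2e^{−κd(X)}N from the family bound on BOTH copies of X); `e^{−κd}·e^{wd} = e^{−(κ−w)d}`; `bound_125` under G1.
[cite: Balaban1987RG1, (4.22) p.286; Balaban1988RG2Cluster, (1.24)-(1.25) p.7] -/
theorem pieceBoundOnG₂_ker {K : KerData C E ι α β γ δ Pt} {ℓ gain : ℕ → ℕ → ℝ} {cK δ₀ δ₁ w w0 c0 c1 d0 : ℝ}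
    (hK : K.Admissible ℓ gain cK δ₀ δ₁ w w0 c0 c1 d0) (κ : ℝ) :
    PieceBoundOnG₂ (analyticClass K.R) K.toC κ (κ - w) K.κ₁ d0 (K.Kp cK w0 c0 c1) gain := by
  intro k s y a ha b hb j x hx H hH N hN hbd
  set X : C.Dom := x.1 with hXdef
  set l := K.cubes k y a b with hl
  set M : ℝ := 2 * (Real.exp (-(κ * C.d X)) * N) with hM
  have hj : C.scale X = j := hK.srcScale k y a j x hx
  have hMbd : ∀ z ∈ ball (0 : E) (K.R X), ‖lift H X z‖ ≤ M := by
    intro z _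
    exact norm_lift_le (hbd z (X, true) hj) (hbd z (X, false) hj)
  have hM0 : 0 ≤ M := by rw [hM]; exact mul_nonneg zero_le_two (mul_nonneg (Real.exp_pos _).le hN)
  -- the integrand bound on the contours
  set S : ℝ := cK * Real.exp w0 * c0 * c1 * M * gain k j * Real.exp (w * C.d X) with hS
  have hS' : ∀ t ∈ Metric.sphere (0:ℂ) (K.r k), ∀ s' σ',
      (∀ i ∈ l, s' i ∈ Set.Icc (0:ℝ) 1 ∧ σ' i ∈ Metric.sphere (0:ℂ) (Real.exp K.κ₁)) →
        ‖K.dsum k s y a b x (lift H X) t s' σ'‖ ≤ S :=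
    fun t ht s' σ' hsσ => norm_dsum_le hK ha hb hx ht hsσ (hH X) hMbd hM0
  have hS0 : 0 ≤ S := by
    rw [hS]
    exact mul_nonneg (mul_nonneg (mul_nonneg (mul_nonneg (mul_nonneg (mul_nonneg hK.cK_nonneg (Real.exp_pos _).le)
      hK.c0_nonneg) hK.c1_nonneg) hM0) (hK.gain_nonneg k j)) (Real.exp_pos _).le
  have h124 := B13Sect1Arith.bound_124 hK.κ₁_ge (hK.r_pos k) hS0 l (fun t s' σ' => K.dsum k s y a b x (lift H X) t s' σ')
    hS' _ _ (onContour_base K.κ₁ l)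
  have h125 := B13Sect1Arith.bound_125 (N := (l.length : ℝ)) (dY := K.dY k y) hK.κ₁_ge hK.d0_nonneg (hK.G1 k y a ha b hb)
  have hr0 : 0 < K.r k := hK.r_pos k
  -- assemble
  show |reIm x.2 ((2 * Real.pi * I : ℂ)⁻¹ • ∮ t in C(0, K.r k), (t ^ 2)⁻¹ •
      B13Sect1Arith.cauchyOp (Real.exp K.κ₁) (K.cubes k y a b) (fun s' σ' => K.dsum k s y a b x (lift H x.1) t s' σ')
        (fun _ => (0:ℝ)) (fun _ => ((Real.exp K.κ₁ : ℝ) : ℂ)))| ≤ K.Kp cK w0 c0 c1 k y * N * gain k j *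
        Real.exp (-((κ - w) * (doubleCarriers C).d x)) *
          Real.exp (-(1 / 8) * (K.κ₁ - 1) * K.toC.dY k y + (1 / 8) * K.κ₁ * d0 -
            (1 / 2) * (K.κ₁ - 1) * K.toC.vol k y a b)
  have hdx : (doubleCarriers C).d x = C.d X := rfl
  have hdY : K.toC.dY k y = K.dY k y := rfl
  have hvol : K.toC.vol k y a b = (l.length : ℝ) := rfl
  have hexp : Real.exp (-(κ * C.d X)) * Real.exp (w * C.d X) = Real.exp (-((κ - w) * C.d X)) := by
    rw [← Real.exp_add]; congr 1; ring
  rw [hdx, hdY, hvol, ← hXdef, ← hl]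
  calc |reIm x.2 ((2 * Real.pi * I : ℂ)⁻¹ • ∮ t in C(0, K.r k), (t ^ 2)⁻¹ •
          B13Sect1Arith.cauchyOp (Real.exp K.κ₁) l (fun s' σ' => K.dsum k s y a b x (lift H X) t s' σ')
            (fun _ => (0:ℝ)) (fun _ => ((Real.exp K.κ₁ : ℝ) : ℂ)))|
        ≤ ‖(2 * Real.pi * I : ℂ)⁻¹ • ∮ t in C(0, K.r k), (t ^ 2)⁻¹ •
          B13Sect1Arith.cauchyOp (Real.exp K.κ₁) l (fun s' σ' => K.dsum k s y a b x (lift H X) t s' σ')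
            (fun _ => (0:ℝ)) (fun _ => ((Real.exp K.κ₁ : ℝ) : ℂ))‖ := abs_reIm_le _ _
    _ ≤ 1 / K.r k * S * Real.exp (-(K.κ₁ - 1) * l.length) := h124
    _ ≤ 1 / K.r k * S *
          Real.exp (-(1 / 8) * (K.κ₁ - 1) * K.dY k y + (1 / 8) * K.κ₁ * d0 - (1 / 2) * (K.κ₁ - 1) * l.length) :=
        mul_le_mul_of_nonneg_left h125 (mul_nonneg (div_pos one_pos hr0).le hS0)
    _ = K.Kp cK w0 c0 c1 k y * N * gain k j * (Real.exp (-(κ * C.d X)) * Real.exp (w * C.d X)) *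
          Real.exp (-(1 / 8) * (K.κ₁ - 1) * K.dY k y + (1 / 8) * K.κ₁ * d0 - (1 / 2) * (K.κ₁ - 1) * l.length) := by
        simp only [KerData.Kp, hS, hM]; ring
    _ = K.Kp cK w0 c0 c1 k y * N * gain k j * Real.exp (-((κ - w) * C.d X)) *
          Real.exp (-(1 / 8) * (K.κ₁ - 1) * K.dY k y + (1 / 8) * K.κ₁ * d0 - (1 / 2) * (K.κ₁ - 1) * l.length) := by
        rw [hexp]

omit [DecidableEq δ] in
/-- `0 ≤ Kp`. [folklore] -/
theorem kp_nonneg_ker {K : KerData C E ι α β γ δ Pt} {ℓ gain : ℕ → ℕ → ℝ} {cK δ₀ δ₁ w w0 c0 c1 d0 : ℝ}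
    (hK : K.Admissible ℓ gain cK δ₀ δ₁ w w0 c0 c1 d0) (k : ℕ) (y : ι) : 0 ≤ K.Kp cK w0 c0 c1 k y :=
  div_nonneg (mul_nonneg (mul_nonneg (mul_nonneg (mul_nonneg zero_le_two hK.cK_nonneg) (Real.exp_pos _).le)
    hK.c0_nonneg) hK.c1_nonneg) (hK.r_pos k).le

/-- **LEAF S5 FOR THE KERNEL SPECIES ON THE ANALYTIC CLASS (the point of the module)**:
`ChannelSizeAtStepNN (analyticClass R) (cpieceChannel K.toC) κ (weightOf K.toC.frame κ₁ d₀ O1 Kp) (tauOfG c_Q ℓ′)` at the INPUT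
rate κ, from `KerData.Admissible` and the level counts AT THE OUTPUT RATE κ − w (`LevelCountsG K.toC.frame (κ − w) …`, [II]
(1.26)–(1.28) with the fibre sums at κ − w) — §1's `channelSizeAtStepNN_cpieceG₂` fed with `pieceZero_ker`, `pieceLocal_ker`,
`csrcScale_ker` and the PROVED `pieceBoundOnG₂_ker`. [cite: Balaban1987RG1, (4.22) p.286; Balaban1988RG2Cluster, (1.24)-(1.29) pp.7-8] -/
theorem channelSizeAtStepNN_ker {K : KerData C E ι α β γ δ Pt} {ℓ ℓ' gain : ℕ → ℕ → ℝ} {cK δ₀ δ₁ w w0 c0 c1 d0 O1 cQ : ℝ}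
    (hK : K.Admissible ℓ gain cK δ₀ δ₁ w w0 c0 c1 d0) (κ : ℝ)
    (hL : LevelCountsG K.toC.frame (κ - w) K.κ₁ O1 cQ gain ℓ') (hO1 : 0 ≤ O1) (hcQℓ : ∀ k j, 0 ≤ cQ * ℓ' k j) :
    ChannelSizeAtStepNN (analyticClass K.R) (cpieceChannel K.toC) κ
      (weightOf K.toC.frame K.κ₁ d0 O1 (K.Kp cK w0 c0 c1)) (tauOfG cQ ℓ') :=
  channelSizeAtStepNN_cpieceG₂ (pieceZero_ker hK.kerZero) (pieceLocal_ker K) (csrcScale_ker hK) (pieceBoundOnG₂_ker hK κ) hL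
    (kp_nonneg_ker hK) hO1 hK.gain_nonneg hcQℓ

/-- `ChannelLocal` and `ChannelStepSum` for the kernel species' channel on ANY class; `AdmRestrict` for the analytic class. [folklore] -/
theorem structureBinders_ker {K : KerData C E ι α β γ δ Pt} {ℓ gain : ℕ → ℕ → ℝ} {cK δ₀ δ₁ w w0 c0 c1 d0 : ℝ}
    (hK : K.Admissible ℓ gain cK δ₀ δ₁ w w0 c0 c1 d0) (Adm : Set (E → (doubleCarriers C).Dom → ℝ)) :
    ChannelLocal Adm (cpieceChannel K.toC) ∧ ChannelStepSum Adm (cpieceChannel K.toC) ∧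
      AdmRestrict (C := doubleCarriers C) (analyticClass (E := E) K.R) :=
  ⟨channelLocal_cpiece (pieceLocal_ker K) (csrcScale_ker hK) Adm,
    channelStepSum_cpiece (pieceZero_ker hK.kerZero) (pieceLocal_ker K) (csrcScale_ker hK) Adm, admRestrict_analyticClass K.R⟩

/-- WHAT S3 STILL NEEDS for the kernel species (displayed): `ChannelAdditive` from `PieceAdditiveOn (analyticClass R) K.toC` —
additivity of `ker` in `F` (print: multilinearity of the derivative kernels) and of the contour integrals on continuous
integrands. [cite: Balaban1987RG1, (4.21) p.285] -/
theorem channelAdditive_ker_of_pieceAdditive {K : KerData C E ι α β γ δ Pt}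
    (hA : PieceAdditiveOn (analyticClass K.R) K.toC) : ChannelAdditive (analyticClass K.R) (cpieceChannel K.toC) :=
  channelAdditive_cpiece hA

end Species

end Summit.QuantumFields.BalabanUV.T4Continuum.NE9Lemma1KernelSpecies
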